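import Summits.Ventures.PercRepro.SixFourResidueThreeGenericTable

/-!
# PercRepro — C-025 at `(6,4)`: the plane-line branch (γ) of the `t = 3` tail, part 2 — the MARGIN table `T₃⁺(g,p) ≥ 12/5`, `11 ≤ g ≤ 100` (p2, gen 10)

The per-pair inequality of Theorem G₃ with the margin `12/5` the plane-line branch needs on the co-collinear planes:
`C(m,2)·(base₃(g,p) + 12/5) ≤ C(p,2)·L₃(g,p,m)` for `3 ≤ p ≤ g − 3`, `2 ≤ m < p` — by `slack_ge_of_mu` with
`μ = (base₃ + 12/5)/C(p,2)` it gives `slack(P) ≥ 12/5` on every rank-`3` trace with `≤ g − 3` points.  Multiplied by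
`10·(g − m)·C(g,2) > 0` it is the integer inequality `PerPairMN g p m` (`base3N + 24 = 10·(base₃ + 12/5)`), decided for
`11 ≤ g ≤ 100` as `perPairMCheck g` (the twin of `perPairCheck`; 147,405 cells, 0 failures, the smallest margin
`T₃⁺ − 12/5 = 3629/550` at `(g, p) = (11, 8)` — session work/margin_check.py, exact rationals).  `g ≥ 101` is mine-2's
`SixFourResidueThreePlaneLineMargin` (`T₃⁺ ≥ a₃(c)·2^p`).
-/

namespace PercRepro.SixFour

/-! ## The integer form with the margin -/

/-- The per-pair inequality with the margin `12/5`, in `ℤ`: `C(m,2)·(base₃N + 24)·(g − m)·C(g,2) ≤ C(p,2)·L₃N`. -/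
def PerPairMN (g p m : ℕ) : Prop :=
  (m.choose 2 : ℤ) * (base3N g p + 24) * ((g - m : ℕ) : ℤ) * (g.choose 2 : ℤ) ≤ (p.choose 2 : ℤ) * LtermN g p m

/-- `PerPairMN` is decidable. -/
instance (g p m : ℕ) : Decidable (PerPairMN g p m) := by unfold PerPairMN; infer_instance

/-- **Transfer**: the integer inequality gives the rational one with the margin `12/5`. -/
theorem perPairM3_of_perPairMN {g p m : ℕ} (hm : m < g) (hg : 2 ≤ g) (h : PerPairMN g p m) :
    (m.choose 2 : ℚ) * (base3 g p + 12 / 5) ≤ (p.choose 2 : ℚ) * Lterm3 g p m := by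
  unfold PerPairMN at h
  have hD : (0 : ℚ) < ((g - m : ℕ) : ℚ) := by
    have : 0 < g - m := by omega
    exact_mod_cast this
  have hC : (0 : ℚ) < (g.choose 2 : ℚ) := by
    have : 0 < g.choose 2 := Nat.choose_pos hg
    exact_mod_cast this
  have hQ : ((m.choose 2 : ℤ) * (base3N g p + 24) * ((g - m : ℕ) : ℤ) * (g.choose 2 : ℤ) : ℚ) ≤
      ((p.choose 2 : ℤ) * LtermN g p m : ℚ) := by exact_mod_cast h
  push_cast at hQ
  rw [LtermN_eq hm hg] at hQ
  have hB : (base3N g p : ℚ) = 10 * base3 g p := by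
    unfold base3N base3 KN
    push_cast
    ring
  rw [hB] at hQ
  have hpos : (0 : ℚ) < 10 * ((g - m : ℕ) : ℚ) * (g.choose 2 : ℚ) := by positivity
  nlinarith [hQ, hpos]

/-! ## The finite checks -/

/-- The margin check at a fixed `g`: `PerPairMN g p m` for every `3 ≤ p ≤ g − 3`, `2 ≤ m < p`. -/
def perPairMCheck (g : ℕ) : Prop :=
  ∀ p < g, ∀ m < p, (!decide (3 ≤ p ∧ p + 3 ≤ g ∧ 2 ≤ m) || decide (PerPairMN g p m)) = true

/-- The margin check at `g = 11` (`decide`). -/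
theorem perPairMCheck_11 : perPairMCheck 11 := by unfold perPairMCheck; decide
/-- The margin check at `g = 12` (`decide`). -/
theorem perPairMCheck_12 : perPairMCheck 12 := by unfold perPairMCheck; decide
/-- The margin check at `g = 13` (`decide`). -/
theorem perPairMCheck_13 : perPairMCheck 13 := by unfold perPairMCheck; decide
/-- The margin check at `g = 14` (`decide`). -/
theorem perPairMCheck_14 : perPairMCheck 14 := by unfold perPairMCheck; decide
/-- The margin check at `g = 15` (`decide`). -/
theorem perPairMCheck_15 : perPairMCheck 15 := by unfold perPairMCheck; decide
/-- The margin check at `g = 16` (`decide`). -/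
theorem perPairMCheck_16 : perPairMCheck 16 := by unfold perPairMCheck; decide
/-- The margin check at `g = 17` (`decide`). -/
theorem perPairMCheck_17 : perPairMCheck 17 := by unfold perPairMCheck; decide
/-- The margin check at `g = 18` (`decide`). -/
theorem perPairMCheck_18 : perPairMCheck 18 := by unfold perPairMCheck; decide
/-- The margin check at `g = 19` (`decide`). -/
theorem perPairMCheck_19 : perPairMCheck 19 := by unfold perPairMCheck; decide
/-- The margin check at `g = 20` (`decide`). -/
theorem perPairMCheck_20 : perPairMCheck 20 := by unfold perPairMCheck; decide
/-- The margin check at `g = 21` (`decide`). -/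
theorem perPairMCheck_21 : perPairMCheck 21 := by unfold perPairMCheck; decide
/-- The margin check at `g = 22` (`decide`). -/
theorem perPairMCheck_22 : perPairMCheck 22 := by unfold perPairMCheck; decide
/-- The margin check at `g = 23` (`decide`). -/
theorem perPairMCheck_23 : perPairMCheck 23 := by unfold perPairMCheck; decide
/-- The margin check at `g = 24` (`decide`). -/
theorem perPairMCheck_24 : perPairMCheck 24 := by unfold perPairMCheck; decide
/-- The margin check at `g = 25` (`decide`). -/
theorem perPairMCheck_25 : perPairMCheck 25 := by unfold perPairMCheck; decide
/-- The margin check at `g = 26` (`decide`). -/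
theorem perPairMCheck_26 : perPairMCheck 26 := by unfold perPairMCheck; decide
/-- The margin check at `g = 27` (`decide`). -/
theorem perPairMCheck_27 : perPairMCheck 27 := by unfold perPairMCheck; decide
/-- The margin check at `g = 28` (`decide`). -/
theorem perPairMCheck_28 : perPairMCheck 28 := by unfold perPairMCheck; decide
/-- The margin check at `g = 29` (`decide`). -/
theorem perPairMCheck_29 : perPairMCheck 29 := by unfold perPairMCheck; decide
/-- The margin check at `g = 30` (`decide`). -/
theorem perPairMCheck_30 : perPairMCheck 30 := by unfold perPairMCheck; decide
/-- The margin check at `g = 31` (`decide`). -/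
theorem perPairMCheck_31 : perPairMCheck 31 := by unfold perPairMCheck; decide
/-- The margin check at `g = 32` (`decide`). -/
theorem perPairMCheck_32 : perPairMCheck 32 := by unfold perPairMCheck; decide
/-- The margin check at `g = 33` (`decide`). -/
theorem perPairMCheck_33 : perPairMCheck 33 := by unfold perPairMCheck; decide
/-- The margin check at `g = 34` (`decide`). -/
theorem perPairMCheck_34 : perPairMCheck 34 := by unfold perPairMCheck; decide
/-- The margin check at `g = 35` (`decide`). -/
theorem perPairMCheck_35 : perPairMCheck 35 := by unfold perPairMCheck; decide
/-- The margin check at `g = 36` (`decide`). -/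
theorem perPairMCheck_36 : perPairMCheck 36 := by unfold perPairMCheck; decide
/-- The margin check at `g = 37` (`decide`). -/
theorem perPairMCheck_37 : perPairMCheck 37 := by unfold perPairMCheck; decide
/-- The margin check at `g = 38` (`decide`). -/
theorem perPairMCheck_38 : perPairMCheck 38 := by unfold perPairMCheck; decide
/-- The margin check at `g = 39` (`decide`). -/
theorem perPairMCheck_39 : perPairMCheck 39 := by unfold perPairMCheck; decide
/-- The margin check at `g = 40` (`decide`). -/
theorem perPairMCheck_40 : perPairMCheck 40 := by unfold perPairMCheck; decide
/-- The margin check at `g = 41` (`decide`). -/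
theorem perPairMCheck_41 : perPairMCheck 41 := by unfold perPairMCheck; decide
/-- The margin check at `g = 42` (`decide`). -/
theorem perPairMCheck_42 : perPairMCheck 42 := by unfold perPairMCheck; decide
/-- The margin check at `g = 43` (`decide`). -/
theorem perPairMCheck_43 : perPairMCheck 43 := by unfold perPairMCheck; decide
/-- The margin check at `g = 44` (`decide`). -/
theorem perPairMCheck_44 : perPairMCheck 44 := by unfold perPairMCheck; decide
/-- The margin check at `g = 45` (`decide`). -/
theorem perPairMCheck_45 : perPairMCheck 45 := by unfold perPairMCheck; decide
/-- The margin check at `g = 46` (`decide`). -/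
theorem perPairMCheck_46 : perPairMCheck 46 := by unfold perPairMCheck; decide
/-- The margin check at `g = 47` (`decide`). -/
theorem perPairMCheck_47 : perPairMCheck 47 := by unfold perPairMCheck; decide
/-- The margin check at `g = 48` (`decide`). -/
theorem perPairMCheck_48 : perPairMCheck 48 := by unfold perPairMCheck; decide
/-- The margin check at `g = 49` (`decide`). -/
theorem perPairMCheck_49 : perPairMCheck 49 := by unfold perPairMCheck; decide
/-- The margin check at `g = 50` (`decide`). -/
theorem perPairMCheck_50 : perPairMCheck 50 := by unfold perPairMCheck; decide
/-- The margin check at `g = 51` (`decide`). -/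
theorem perPairMCheck_51 : perPairMCheck 51 := by unfold perPairMCheck; decide
/-- The margin check at `g = 52` (`decide`). -/
theorem perPairMCheck_52 : perPairMCheck 52 := by unfold perPairMCheck; decide
/-- The margin check at `g = 53` (`decide`). -/
theorem perPairMCheck_53 : perPairMCheck 53 := by unfold perPairMCheck; decide
/-- The margin check at `g = 54` (`decide`). -/
theorem perPairMCheck_54 : perPairMCheck 54 := by unfold perPairMCheck; decide
/-- The margin check at `g = 55` (`decide`). -/
theorem perPairMCheck_55 : perPairMCheck 55 := by unfold perPairMCheck; decide
/-- The margin check at `g = 56` (`decide`). -/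
theorem perPairMCheck_56 : perPairMCheck 56 := by unfold perPairMCheck; decide
/-- The margin check at `g = 57` (`decide`). -/
theorem perPairMCheck_57 : perPairMCheck 57 := by unfold perPairMCheck; decide
/-- The margin check at `g = 58` (`decide`). -/
theorem perPairMCheck_58 : perPairMCheck 58 := by unfold perPairMCheck; decide
/-- The margin check at `g = 59` (`decide`). -/
theorem perPairMCheck_59 : perPairMCheck 59 := by unfold perPairMCheck; decide
/-- The margin check at `g = 60` (`decide`). -/
theorem perPairMCheck_60 : perPairMCheck 60 := by unfold perPairMCheck; decide
set_option maxRecDepth 20000 in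
/-- The margin check at `g = 61` (`decide`). -/
theorem perPairMCheck_61 : perPairMCheck 61 := by unfold perPairMCheck; decide
set_option maxRecDepth 20000 in
/-- The margin check at `g = 62` (`decide`). -/
theorem perPairMCheck_62 : perPairMCheck 62 := by unfold perPairMCheck; decide
set_option maxRecDepth 20000 in
/-- The margin check at `g = 63` (`decide`). -/
theorem perPairMCheck_63 : perPairMCheck 63 := by unfold perPairMCheck; decide
set_option maxRecDepth 20000 in
/-- The margin check at `g = 64` (`decide`). -/
theorem perPairMCheck_64 : perPairMCheck 64 := by unfold perPairMCheck; decide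
set_option maxRecDepth 20000 in
/-- The margin check at `g = 65` (`decide`). -/
theorem perPairMCheck_65 : perPairMCheck 65 := by unfold perPairMCheck; decide
set_option maxRecDepth 20000 in
/-- The margin check at `g = 66` (`decide`). -/
theorem perPairMCheck_66 : perPairMCheck 66 := by unfold perPairMCheck; decide
set_option maxRecDepth 20000 in
/-- The margin check at `g = 67` (`decide`). -/
theorem perPairMCheck_67 : perPairMCheck 67 := by unfold perPairMCheck; decide
set_option maxRecDepth 20000 in
/-- The margin check at `g = 68` (`decide`). -/
theorem perPairMCheck_68 : perPairMCheck 68 := by unfold perPairMCheck; decide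
set_option maxRecDepth 20000 in
/-- The margin check at `g = 69` (`decide`). -/
theorem perPairMCheck_69 : perPairMCheck 69 := by unfold perPairMCheck; decide
set_option maxRecDepth 20000 in
/-- The margin check at `g = 70` (`decide`). -/
theorem perPairMCheck_70 : perPairMCheck 70 := by unfold perPairMCheck; decide
set_option maxRecDepth 20000 in
/-- The margin check at `g = 71` (`decide`). -/
theorem perPairMCheck_71 : perPairMCheck 71 := by unfold perPairMCheck; decide
set_option maxRecDepth 20000 in
/-- The margin check at `g = 72` (`decide`). -/
theorem perPairMCheck_72 : perPairMCheck 72 := by unfold perPairMCheck; decide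
set_option maxRecDepth 20000 in
/-- The margin check at `g = 73` (`decide`). -/
theorem perPairMCheck_73 : perPairMCheck 73 := by unfold perPairMCheck; decide
set_option maxRecDepth 20000 in
/-- The margin check at `g = 74` (`decide`). -/
theorem perPairMCheck_74 : perPairMCheck 74 := by unfold perPairMCheck; decide
set_option maxRecDepth 20000 in
/-- The margin check at `g = 75` (`decide`). -/
theorem perPairMCheck_75 : perPairMCheck 75 := by unfold perPairMCheck; decide
set_option maxRecDepth 20000 in
/-- The margin check at `g = 76` (`decide`). -/
theorem perPairMCheck_76 : perPairMCheck 76 := by unfold perPairMCheck; decide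
set_option maxRecDepth 20000 in
/-- The margin check at `g = 77` (`decide`). -/
theorem perPairMCheck_77 : perPairMCheck 77 := by unfold perPairMCheck; decide
set_option maxRecDepth 20000 in
/-- The margin check at `g = 78` (`decide`). -/
theorem perPairMCheck_78 : perPairMCheck 78 := by unfold perPairMCheck; decide
set_option maxRecDepth 20000 in
/-- The margin check at `g = 79` (`decide`). -/
theorem perPairMCheck_79 : perPairMCheck 79 := by unfold perPairMCheck; decide
set_option maxRecDepth 20000 in
/-- The margin check at `g = 80` (`decide`). -/
theorem perPairMCheck_80 : perPairMCheck 80 := by unfold perPairMCheck; decide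
set_option maxRecDepth 20000 in
/-- The margin check at `g = 81` (`decide`). -/
theorem perPairMCheck_81 : perPairMCheck 81 := by unfold perPairMCheck; decide
set_option maxRecDepth 20000 in
/-- The margin check at `g = 82` (`decide`). -/
theorem perPairMCheck_82 : perPairMCheck 82 := by unfold perPairMCheck; decide
set_option maxRecDepth 20000 in
/-- The margin check at `g = 83` (`decide`). -/
theorem perPairMCheck_83 : perPairMCheck 83 := by unfold perPairMCheck; decide
set_option maxRecDepth 20000 in
/-- The margin check at `g = 84` (`decide`). -/
theorem perPairMCheck_84 : perPairMCheck 84 := by unfold perPairMCheck; decide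
set_option maxRecDepth 20000 in
/-- The margin check at `g = 85` (`decide`). -/
theorem perPairMCheck_85 : perPairMCheck 85 := by unfold perPairMCheck; decide
set_option maxRecDepth 20000 in
/-- The margin check at `g = 86` (`decide`). -/
theorem perPairMCheck_86 : perPairMCheck 86 := by unfold perPairMCheck; decide
set_option maxRecDepth 20000 in
/-- The margin check at `g = 87` (`decide`). -/
theorem perPairMCheck_87 : perPairMCheck 87 := by unfold perPairMCheck; decide
set_option maxRecDepth 20000 in
/-- The margin check at `g = 88` (`decide`). -/
theorem perPairMCheck_88 : perPairMCheck 88 := by unfold perPairMCheck; decide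
set_option maxRecDepth 20000 in
/-- The margin check at `g = 89` (`decide`). -/
theorem perPairMCheck_89 : perPairMCheck 89 := by unfold perPairMCheck; decide
set_option maxRecDepth 20000 in
/-- The margin check at `g = 90` (`decide`). -/
theorem perPairMCheck_90 : perPairMCheck 90 := by unfold perPairMCheck; decide
set_option maxRecDepth 20000 in
/-- The margin check at `g = 91` (`decide`). -/
theorem perPairMCheck_91 : perPairMCheck 91 := by unfold perPairMCheck; decide
set_option maxRecDepth 20000 in
/-- The margin check at `g = 92` (`decide`). -/
theorem perPairMCheck_92 : perPairMCheck 92 := by unfold perPairMCheck; decide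
set_option maxRecDepth 20000 in
/-- The margin check at `g = 93` (`decide`). -/
theorem perPairMCheck_93 : perPairMCheck 93 := by unfold perPairMCheck; decide
set_option maxRecDepth 20000 in
/-- The margin check at `g = 94` (`decide`). -/
theorem perPairMCheck_94 : perPairMCheck 94 := by unfold perPairMCheck; decide
set_option maxRecDepth 20000 in
/-- The margin check at `g = 95` (`decide`). -/
theorem perPairMCheck_95 : perPairMCheck 95 := by unfold perPairMCheck; decide
set_option maxRecDepth 20000 in
/-- The margin check at `g = 96` (`decide`). -/
theorem perPairMCheck_96 : perPairMCheck 96 := by unfold perPairMCheck; decide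
set_option maxRecDepth 20000 in
/-- The margin check at `g = 97` (`decide`). -/
theorem perPairMCheck_97 : perPairMCheck 97 := by unfold perPairMCheck; decide
set_option maxRecDepth 20000 in
/-- The margin check at `g = 98` (`decide`). -/
theorem perPairMCheck_98 : perPairMCheck 98 := by unfold perPairMCheck; decide
set_option maxRecDepth 20000 in
/-- The margin check at `g = 99` (`decide`). -/
theorem perPairMCheck_99 : perPairMCheck 99 := by unfold perPairMCheck; decide
set_option maxRecDepth 20000 in
/-- The margin check at `g = 100` (`decide`). -/
theorem perPairMCheck_100 : perPairMCheck 100 := by unfold perPairMCheck; decide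

/-- `perPairMCheck g` for every `11 ≤ g ≤ 100`. -/
theorem perPairMCheck_of_range {g : ℕ} (hg : 11 ≤ g) (hg' : g ≤ 100) : perPairMCheck g := by
  interval_cases g
  exacts [perPairMCheck_11, perPairMCheck_12, perPairMCheck_13, perPairMCheck_14, perPairMCheck_15, perPairMCheck_16, perPairMCheck_17, perPairMCheck_18, perPairMCheck_19, perPairMCheck_20, perPairMCheck_21, perPairMCheck_22, perPairMCheck_23, perPairMCheck_24, perPairMCheck_25, perPairMCheck_26, perPairMCheck_27, perPairMCheck_28, perPairMCheck_29, perPairMCheck_30, perPairMCheck_31, perPairMCheck_32, perPairMCheck_33, perPairMCheck_34, perPairMCheck_35, perPairMCheck_36, perPairMCheck_37, perPairMCheck_38, perPairMCheck_39, perPairMCheck_40, perPairMCheck_41, perPairMCheck_42, perPairMCheck_43, perPairMCheck_44, perPairMCheck_45, perPairMCheck_46, perPairMCheck_47, perPairMCheck_48, perPairMCheck_49, perPairMCheck_50, perPairMCheck_51, perPairMCheck_52, perPairMCheck_53, perPairMCheck_54, perPairMCheck_55, perPairMCheck_56, perPairMCheck_57, perPairMCheck_58, perPairMCheck_59, perPairMCheck_60,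 perPairMCheck_61, perPairMCheck_62, perPairMCheck_63, perPairMCheck_64, perPairMCheck_65, perPairMCheck_66, perPairMCheck_67, perPairMCheck_68, perPairMCheck_69, perPairMCheck_70, perPairMCheck_71, perPairMCheck_72, perPairMCheck_73, perPairMCheck_74, perPairMCheck_75, perPairMCheck_76, perPairMCheck_77, perPairMCheck_78, perPairMCheck_79, perPairMCheck_80, perPairMCheck_81, perPairMCheck_82, perPairMCheck_83, perPairMCheck_84, perPairMCheck_85, perPairMCheck_86, perPairMCheck_87, perPairMCheck_88, perPairMCheck_89, perPairMCheck_90, perPairMCheck_91, perPairMCheck_92, perPairMCheck_93, perPairMCheck_94, perPairMCheck_95, perPairMCheck_96, perPairMCheck_97, perPairMCheck_98, perPairMCheck_99, perPairMCheck_100]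

/-- **The per-pair inequality with the margin `12/5` for `11 ≤ g ≤ 100`**, `3 ≤ p ≤ g − 3`, `2 ≤ m < p`. -/
theorem perPairM3_of_range {g p m : ℕ} (hg : 11 ≤ g) (hg' : g ≤ 100) (hp : 3 ≤ p) (hpg : p + 3 ≤ g) (hm : 2 ≤ m)
    (hmp : m < p) : (m.choose 2 : ℚ) * (base3 g p + 12 / 5) ≤ (p.choose 2 : ℚ) * Lterm3 g p m := by
  have hc := perPairMCheck_of_range hg hg' p (by omega) m hmp
  rw [Bool.or_eq_true, Bool.not_eq_true', decide_eq_false_iff_not, decide_eq_true_eq] at hc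
  have hN : PerPairMN g p m := hc.resolve_left (not_not.2 ⟨hp, hpg, hm⟩)
  exact perPairM3_of_perPairMN (by omega) (by omega) hN

end PercRepro.SixFour
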